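import Summits.QuantumFields.BalabanUV.Beta.D1BFx.RestKernelGhostWiring
import Summits.QuantumFields.BalabanUV.Beta.D1BFx.RestKernelDeltaGHWiring

/-!
# `BalabanUV.Beta.D1BFx.RestKernelGhostSlot` — road «BF-x» for binder row D1, slot (K): **«GHOST SLOT PACK» — THE WHOLE GHOST LANE AS ONE
# MEMBER FAMILY `RkGhost ω a : GhIdx ⊕ Unit → ℕ → …` OF THE JOINT ROOT's (K) SLOT, WITH ITS `hMR` ∕ `hRu` ∕ `hU` ROWS, ITS n-FREE `hU₁` FRAGMENT
# `Σ_u CU′ u = Ω·(12·KU(a) + KΔ(a))`, AND ITS POINTWISE SUM** (OWNER WORD W-d1p2-g18-2 on OFFER O-d1leaf01-g22-1: «GO, THIS SHAPE … the (K6c) assembly will be ONE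
# `Sum.elim` over LANES, and a lane that arrives as one member with its n-free `hU₁` fragment and its pointwise sum is exactly the unit the assembly wants»)

HONEST DEPENDENCY (cell records, verbatim): «continuum YM on T⁴ ⇐ BetaPertH ∧ nine spine estimates (0/9 proved); BetaPertH ⇐ (D1) ∧ (D4) ∧
CAP+tail; G-an2-4 gates asym, D1 and NE2/3/4.»  HONEST FRAMING (cell contract, verbatim): «discharging `BetaPertH` makes Bałaban's UV stability
UNCONDITIONAL — a real constructive-QFT result; it is NOT the continuum limit and NOT the Clay problem.»  THIS MODULE DISCHARGES NOTHING of the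
wall: [folklore] `Sum.elim` ∕ `Fintype.sum_sum_type` bookkeeping over the two LANDED ghost wirings — «RK-GH-WIRE» `RestKernelGhostWiring` (p316918 ✓: the
twelve ghost rest words `RkGh ω a : GhIdx → …`, constant `KU(a)`) and «ΔGH-WIRE» `RestKernelDeltaGHWiring` (p319306 ✓: the pinned-minus-ray defect `RkDGH ω a`,
constant `KΔ(a)`) — BY NAME, plus three [our object] DATA definitions (`RkGhost`, `CUgh`, `RuGhost`; asserting nothing).  UNCONDITIONAL (`0 < a`, a displayed
weight bound `|ω n| ≤ Ω`); no `h12`∕`h126`, no printed statement, no `def … : Prop`, nothing cited, 0 sorry.  The loop weight `ω` and its bound `Ω` stay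
GENERIC (RULING ρ-g17-1: `ω := fun _ => −1`, `Ω := 1` provisional — the consumer's).  0 root-level binders of row D1 discharged (hW ∕ hR-sockets ∕ hSX-socket ∕
D1Tel ∕ D1Rep — 0); (K) NOT closed (the slot needs the gluon∕sandwich∕block lanes after (A2-N), the dictionary `hptw` itself, and ALL of `υ`); NOT D1, NOT
`BetaPertH`, NOT continuum, NOT Clay.

ABSOLUTE RULE (cell charter, verbatim): «No internally-minted statement may enter as a cited fact. Every hypothesis is either kernel-proved in
this package or a verbatim quotation of a PUBLISHED theorem with page reference. The manuscript(s) under audit are NOT citable for their own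
disputed steps — they are the thing under adjudication; programme-internal (2001/route/tribunal) claims are never citable.»

THE SHAPES (the JOINT ROOT `RoadEndBFxJointCombShSym` p314721 ∕ the (K1) END `RoadEndBFxDictPointwiseS.hdict_of_pointwise`, at `υ := GhIdx ⊕ Unit`,
`Rk := RkGhost ω a`): `hMR : ∀ u m, 1 ≤ m → AbsMoment₂ (Rk u (Lc^m) μ ν)`; `hRu : ∀ u m, 1 ≤ m → |secondMoment (Rk u (Lc^m)) μ ν − Ru u (Lc^m)| ≤ CU′ u`;
`hU₁ : Σ_u CU′ u ≤ U₁`; `hU : ∀ n, 2 ≤ n → ∀ u, |Ru u n| ≤ CU u`.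

CONTENT.
* §1 [our object] **`RkGhost ω a := Sum.elim (RkGh ω a) (fun _ => RkDGH ω a)`**; `RkGhost_inl` ∕ `RkGhost_inr` (`rfl`); [folklore] **`hMR_RkGhost`** (by cases,
  `hMR_RkGh` ⊕ `hMR_RkDGH`).
* §2 [our object] **`CUgh a Ω := Sum.elim (fun _ => Ω·KU(a)) (fun _ => Ω·KΔ(a))`** (the n-free read-out constant per member); [folklore] `card_GhIdx` (= 12),
  **`sum_CUgh : Σ_u CUgh a Ω u = Ω·(12·KU(a) + KΔ(a))`** and the `hU₁` fragment `sum_CUgh_le` (`≤`, by `le_of_eq`); `CUgh_nonneg` (`0 ≤ Ω`).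
* §3 READING (b) = ρ-g16-2 (2) (the one the JOINT ROOT consumes): **`hRu_zero_RkGhost (hω)`** (`Ru := 0`, `CU′ := CUgh a Ω`), `hU_zero_ghost` (`CU := 0`);
  READING (a): [our object] `RuGhost := Sum.elim (RuGh ω a μ ν) (RuDGH ω a μ ν)`, [folklore] **`hRu_RuGhost`** (`CU′ := 0`), **`hU_RuGhost (hω)`** (`CU := CUgh a Ω`);
  the n-uniform unit row per member `abs_secondMoment_RkGhost_le_unit`.
* §4 [folklore] the POINTWISE SUM: `sum_RkGhost` (`= Σ_i RkGh … + RkDGH …`), **`sum_RkGhost_of_neZero`** (`= ω n·(Σ_i ghostWordK (Ggh n a) (Pgt n a) 𝒱J 𝒲J i μ ν z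
  + 2·(PghQ n a (−1) n² 0 − PghQ n a (−1) n² a) μ ν z)` at any `[NeZero n]` — what the dictionary `hptw` matches against the ghost part of `Σ_u Rk u`), `sum_RkGhost_zero`.
NOT HERE (honest): `hptw`; the gluon∕sandwich∕block lanes; any statement about `TshotOf`; the value of `ω`.
Unit `b2b-balaban-beta-d1-formalise-leaf-01` (gen 22), D1 formalisation swarm leaf prover 01, road «BF-x»; OFFER O-d1leaf01-g22-1 → OWNER W-d1p2-g18-2 «GO, THIS SHAPE» (journal).
-/

noncomputable section

open Finset
open scoped BigOperators
open Literature.MathematicalPhysics.QuantumFieldTheory.Balaban1983to89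
open Literature.MathematicalPhysics.QuantumFieldTheory.Balaban1983to89.Beta
open ExpKernelCalculus (Site)
open DecimatedMomentSummable (AbsMoment₂)
open Summit.QuantumFields.BalabanUV.Beta.D1BFx.GhostKernelComplete (PghQ)
open Summit.QuantumFields.BalabanUV.Beta.D1BFx.RProjector (Pgt)
open Summit.QuantumFields.BalabanUV.Beta.D1BFx.GhostLeg (Ggh)
open Summit.QuantumFields.BalabanUV.Beta.D1BFx.GhostStencil (ghCur)
open Summit.QuantumFields.BalabanUV.Beta.D1BFx.TorusGhostPairStencils (gh₂)
open Summit.QuantumFields.BalabanUV.Beta.D1BFx.ReducedKernelF (vertexRedF)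
open Summit.QuantumFields.BalabanUV.Beta.D1BFx.ReducedTableF (tableRedF)
open Summit.QuantumFields.BalabanUV.Beta.D1BFx.RestKernelGhostWords (GhIdx ghostWordK)
open Summit.QuantumFields.BalabanUV.Beta.D1BFx.RestKernelGhostWiring (RkGh RkGh_zero RkGh_of_neZero hMR_RkGh KUgh KUgh_nonneg
  abs_secondMoment_RkGh_le_unit RuGh hRu_RuGh hU_RuGh hRu_zero_RkGh sum_RkGh_of_neZero sum_RkGh_zero)
open Summit.QuantumFields.BalabanUV.Beta.D1BFx.RestKernelDeltaGHWiring (RkDGH RkDGH_zero RkDGH_of_neZero hMR_RkDGH KDgh KDgh_nonneg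
  abs_secondMoment_RkDGH_le_unit RuDGH hRu_RuDGH hU_RuDGH hRu_zero_RkDGH)

namespace Summit.QuantumFields.BalabanUV.Beta.D1BFx.RestKernelGhostSlot

/-! ## §1 The ghost lane as ONE member family over `GhIdx ⊕ Unit` -/

/-- [our object] **THE GHOST LANE OF THE (K) SLOT**: the twelve ghost rest words (index `Sum.inl i`, `i : GhIdx`) and the pinned-minus-ray defect `ΔGH`
(index `Sum.inr ()`), each TOTAL in the block size, under one displayed loop-weight family `ω`.  A DEFINITION; asserts nothing. -/
def RkGhost (ω : ℕ → ℝ) (a : ℝ) : GhIdx ⊕ Unit → ℕ → Fin 4 → Fin 4 → Site 4 → ℝ :=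
  Sum.elim (RkGh ω a) (fun _ => RkDGH ω a)

/-- [our object] The word members. -/
theorem RkGhost_inl (ω : ℕ → ℝ) (a : ℝ) (i : GhIdx) : RkGhost ω a (Sum.inl i) = RkGh ω a i := rfl

/-- [our object] The defect member. -/
theorem RkGhost_inr (ω : ℕ → ℝ) (a : ℝ) (u : Unit) : RkGhost ω a (Sum.inr u) = RkDGH ω a := rfl

section Rows

variable (ω : ℕ → ℝ) {a : ℝ} (ha : 0 < a)
include ha

/-- [folklore] **THE END's `hMR` ROW FOR THE WHOLE GHOST LANE** (`υ := GhIdx ⊕ Unit`, `Rk := RkGhost ω a`; any weight, any `[NeZero Lc]`):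
`hMR_RkGh` on the words, `hMR_RkDGH` on the defect. -/
theorem hMR_RkGhost {Lc : ℕ} [NeZero Lc] (μ ν : Fin 4) :
    ∀ (u : GhIdx ⊕ Unit) (m : ℕ), 1 ≤ m → AbsMoment₂ (RkGhost ω a u (Lc ^ m) μ ν) := by
  rintro (i | u) m hm
  · exact hMR_RkGh ω ha μ ν i m hm
  · exact hMR_RkDGH ω ha μ ν u m hm

end Rows

/-! ## §2 The n-free read-out constants per member and the lane's `hU₁` fragment -/

/-- [our object] **THE n-FREE READ-OUT CONSTANT PER MEMBER**: `Ω·KU(a)` on each of the twelve words, `Ω·KΔ(a)` on the defect (`Ω` the displayed bound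
of the loop weight).  A DEFINITION of a real-valued table; asserts nothing. -/
def CUgh (a Ω : ℝ) : GhIdx ⊕ Unit → ℝ :=
  Sum.elim (fun _ => Ω * KUgh a) (fun _ => Ω * KDgh a)

/-- [our object] … on a word member. -/
theorem CUgh_inl (a Ω : ℝ) (i : GhIdx) : CUgh a Ω (Sum.inl i) = Ω * KUgh a := rfl

/-- [our object] … on the defect member. -/
theorem CUgh_inr (a Ω : ℝ) (u : Unit) : CUgh a Ω (Sum.inr u) = Ω * KDgh a := rfl

/-- [folklore] The word index has twelve elements (`Bool ⊕ (Option Bool × Bool) ⊕ (Bool ⊕ Bool)`: `2 + 3·2 + 4`). -/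
theorem card_GhIdx : Fintype.card GhIdx = 12 := by
  simp [GhIdx, Fintype.card_sum, Fintype.card_prod, Fintype.card_option, Fintype.card_bool]

/-- [folklore] **THE LANE's `hU₁` FRAGMENT, EXACTLY**: `Σ_u CUgh a Ω u = Ω·(12·KU(a) + KΔ(a))` — n-free. -/
theorem sum_CUgh (a Ω : ℝ) : ∑ u : GhIdx ⊕ Unit, CUgh a Ω u = Ω * (12 * KUgh a + KDgh a) := by
  rw [Fintype.sum_sum_type]
  simp only [CUgh, Sum.elim_inl, Sum.elim_inr, Finset.sum_const, Finset.card_univ, card_GhIdx, Fintype.card_unit,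
    nsmul_eq_mul, Nat.cast_ofNat, Nat.cast_one, one_mul]
  ring

/-- [folklore] … as the inequality the END's `hU₁` binder displays (`U₁ := Ω·(12·KU(a) + KΔ(a))` for the ghost lane alone). -/
theorem sum_CUgh_le (a Ω : ℝ) : ∑ u : GhIdx ⊕ Unit, CUgh a Ω u ≤ Ω * (12 * KUgh a + KDgh a) :=
  (sum_CUgh a Ω).le

/-- [folklore] The read-out constants are nonnegative for a nonnegative weight bound (`0 < a`). -/
theorem CUgh_nonneg {a : ℝ} (ha : 0 < a) {Ω : ℝ} (hΩ : 0 ≤ Ω) : ∀ u : GhIdx ⊕ Unit, 0 ≤ CUgh a Ω u := by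
  rintro (i | u)
  · exact mul_nonneg hΩ (KUgh_nonneg ha)
  · exact mul_nonneg hΩ (KDgh_nonneg ha)

/-! ## §3 The read-out rows, both readings -/

section UnitRow

variable (ω : ℕ → ℝ) {a : ℝ} (ha : 0 < a)
include ha

/-- [folklore] **THE n-UNIFORM UNIT ROW PER MEMBER** under `|ω n| ≤ Ω`: `|secondMoment (RkGhost ω a u n) μ ν| ≤ CUgh a Ω u` for every `n ≥ 1`
(`abs_secondMoment_RkGh_le_unit` ⊕ `abs_secondMoment_RkDGH_le_unit`; the `n⁻²` ∕ `n⁻¹` surpluses are kept in the lane files). -/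
theorem abs_secondMoment_RkGhost_le_unit {Ω : ℝ} (hω : ∀ n, |ω n| ≤ Ω) (u : GhIdx ⊕ Unit) {n : ℕ} (hn : 1 ≤ n) (μ ν : Fin 4) :
    |B12Beta.secondMoment (RkGhost ω a u n) μ ν| ≤ CUgh a Ω u := by
  rcases u with i | u
  · exact abs_secondMoment_RkGh_le_unit ω ha hω i hn μ ν
  · exact abs_secondMoment_RkDGH_le_unit ω ha hω hn μ ν

/-- [folklore] READING (b) = OWNER RULING ρ-g16-2 (2), **THE END's `hRu` ROW FOR THE WHOLE GHOST LANE** with `Ru := 0`, `CU′ := CUgh a Ω`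
(`0 < a`, `|ω n| ≤ Ω`; any `[NeZero Lc]`). -/
theorem hRu_zero_RkGhost {Lc : ℕ} [NeZero Lc] {Ω : ℝ} (hω : ∀ n, |ω n| ≤ Ω) (μ ν : Fin 4) :
    ∀ (u : GhIdx ⊕ Unit) (m : ℕ), 1 ≤ m →
      |B12Beta.secondMoment (RkGhost ω a u (Lc ^ m)) μ ν - (fun (_ : GhIdx ⊕ Unit) (_ : ℕ) => (0 : ℝ)) u (Lc ^ m)| ≤ CUgh a Ω u := by
  rintro (i | u) m hm
  · exact hRu_zero_RkGh ω ha hω μ ν i m hm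
  · exact hRu_zero_RkDGH ω ha hω μ ν u m hm

omit ha in
/-- [folklore] READING (b), the `hU` row is vacuous: `|0| ≤ 0`. -/
theorem hU_zero_ghost : ∀ n : ℕ, 2 ≤ n → ∀ u : GhIdx ⊕ Unit,
    |(fun (_ : GhIdx ⊕ Unit) (_ : ℕ) => (0 : ℝ)) u n| ≤ (fun _ : GhIdx ⊕ Unit => (0 : ℝ)) u :=
  fun _ _ _ => by simp

end UnitRow

/-- [our object] READING (a): the lane's `Ru` at the fixed channel `μ ν` is the second moment of each weighted member (`RuGh` ⊕ `RuDGH`).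
A DEFINITION; asserts nothing. -/
def RuGhost (ω : ℕ → ℝ) (a : ℝ) (μ ν : Fin 4) : GhIdx ⊕ Unit → ℕ → ℝ :=
  Sum.elim (RuGh ω a μ ν) (RuDGH ω a μ ν)

section ReadingA

variable (ω : ℕ → ℝ) {a : ℝ}

/-- [folklore] READING (a), **THE END's `hRu` ROW** with `CU′ := 0`. -/
theorem hRu_RuGhost {Lc : ℕ} (μ ν : Fin 4) :
    ∀ (u : GhIdx ⊕ Unit) (m : ℕ), 1 ≤ m →
      |B12Beta.secondMoment (RkGhost ω a u (Lc ^ m)) μ ν - RuGhost ω a μ ν u (Lc ^ m)| ≤ (fun _ : GhIdx ⊕ Unit => (0 : ℝ)) u := by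
  rintro (i | u) m hm
  · exact hRu_RuGh ω μ ν i m hm
  · exact hRu_RuDGH ω μ ν u m hm

/-- [folklore] READING (a), **THE END's `hU` ROW** with `CU := CUgh a Ω` (`0 < a`, `|ω n| ≤ Ω`). -/
theorem hU_RuGhost (ha : 0 < a) {Ω : ℝ} (hω : ∀ n, |ω n| ≤ Ω) (μ ν : Fin 4) :
    ∀ n : ℕ, 2 ≤ n → ∀ u : GhIdx ⊕ Unit, |RuGhost ω a μ ν u n| ≤ CUgh a Ω u := by
  rintro n hn (i | u)
  · exact hU_RuGh ω ha hω μ ν n hn i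
  · exact hU_RuDGH ω ha hω μ ν n hn u

end ReadingA

/-! ## §4 The lane's contribution to `Σ_u Rk u n μ ν z`, pointwise (what the dictionary will quote) -/

/-- [folklore] The lane's pointwise sum splits as the twelve words plus the defect (`Fintype.sum_sum_type`). -/
theorem sum_RkGhost (ω : ℕ → ℝ) (a : ℝ) (n : ℕ) (μ ν : Fin 4) (z : Site 4) :
    ∑ u : GhIdx ⊕ Unit, RkGhost ω a u n μ ν z = (∑ i : GhIdx, RkGh ω a i n μ ν z) + RkDGH ω a n μ ν z := by
  rw [Fintype.sum_sum_type]
  simp [RkGhost]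

/-- [folklore] **THE GHOST LANE's CONTRIBUTION TO `Σ_u Rk u n μ ν z` AT ANY `[NeZero n]`**: `ω n` times (the twelve ghost rest words of record + the
pinned-minus-ray defect `2·(PghQ n a (−1) n² 0 − PghQ n a (−1) n² a)`) — `sum_RkGh_of_neZero` + `RkDGH_of_neZero`. -/
theorem sum_RkGhost_of_neZero (ω : ℕ → ℝ) (a : ℝ) (n : ℕ) [NeZero n] (μ ν : Fin 4) (z : Site 4) :
    ∑ u : GhIdx ⊕ Unit, RkGhost ω a u n μ ν z
      = ω n * ((∑ i : GhIdx, ghostWordK (Ggh n a) (Pgt n a) (fun κ u => (((n : ℕ) : ℝ) ^ 2) • vertexRedF n (fun κ u => ghCur κ u) κ u)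
            (fun κ u l u' => (((n : ℕ) : ℝ) ^ 2) • tableRedF n (fun κ u l u' => if u = u' ∧ κ = l then gh₂ κ u else 0) κ u l u') i μ ν z)
          + 2 * (PghQ n a (-1) (((n : ℝ) ^ 2)) 0 μ ν z - PghQ n a (-1) (((n : ℝ) ^ 2)) a μ ν z)) := by
  rw [sum_RkGhost, sum_RkGh_of_neZero, RkDGH_of_neZero]
  ring

/-- [folklore] … and at the junk block size it is `0`. -/
theorem sum_RkGhost_zero (ω : ℕ → ℝ) (a : ℝ) (μ ν : Fin 4) (z : Site 4) : ∑ u : GhIdx ⊕ Unit, RkGhost ω a u 0 μ ν z = 0 := by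
  rw [sum_RkGhost, sum_RkGh_zero, RkDGH_zero, zero_add]

end Summit.QuantumFields.BalabanUV.Beta.D1BFx.RestKernelGhostSlot

end
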